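import Mathlib
import Literature.Analysis.FluidPDE.Tao2016AveragedNS.RenormalisedCascadeWaves
import Literature.Analysis.FluidPDE.Tao2016AveragedNS.LocalCascadeSolutions
import HarnessLib

/-!
# Route TaoLadderRungTwoBreak — the TWIN-ROTOR TABLE: a pure-rotor member of `E₂(1)` whose diagonal
# carries the Katz–Pavlović / dyadic chain (definitions file, D-0016; objects used by the sibling proof
# file `TaoLadderRungTwoBreakNoSurvivingEternalViscBddOneTwinRotorEmbedding`, `--supports`
# stmt-NavierStokesRegularity-20419)

MODEL lattice (Tao 2016 §4) only; nothing here is a statement about the Navier–Stokes equations; no stub,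
crux, rung or summit is proved by this file.

The cruxes of route TaoLadderRungTwoBreak (⟨20419⟩ `NoSurvivingEternalViscBddOne`, its registered stubs
(ρ0) `NoSurvivingEternalBdd R 1` / (ρ+) `NoLoudLadder R`, ⟨20205⟩'s `stub_eternalLiouville`) quantify
`∀ R ≥ 1` over the comparable table class `E₂(R) = InTableClass R` (symmetric (4.2), cancelling (4.3),
non-zero structure constants of modulus in `[R⁻¹, 1]`).  The tree's scalar dyadic member `dyadicTable`
(entries `1, −1/2, −1/2`: the square feed `x_{n-1}² ↦ x_n` and its back-reaction) enters the class exactly at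
`R = 2` (`SubDyadicSpread.inTableClass_dyadicTable_iff`), and below the dyadic spread `R < 2` a comparable
table has NO square monomials at all (`SubDyadicSpread.sqCoeff_eq_zero_of_lt_two`).

This file records the object showing that the corner `1 ≤ R < 2` is nevertheless NOT free of
Katz–Pavlović dynamics.  `twinRotorTable` couples the two «twin» modes `0, 1` of `ℝ⁴` by the two CROSS feeds
`x_{0,n-1} x_{1,n-1} ↦ x_{0,n}` and `x_{0,n-1} x_{1,n-1} ↦ x_{1,n}` (coefficient `1` on both orderings) with
the back-reactions `x_{0,n-1} x_{1,n} ↦ x_{1,n-1}` and `x_{1,n-1} x_{0,n} ↦ x_{0,n-1}` (coefficient `−1`): two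
pure rotors (in the triad `{(0,n-1), (1,n-1), (1,n)}` mode `(0,n-1)` is a catalyst moving energy
`(1,n-1) → (1,n)`, and symmetrically with the twins exchanged); every entry lies in `{0, 1, −1}`, so the
table is symmetric, cancelling and `1`-comparable: `twinRotorTable ∈ E₂(R)` for EVERY `R ≥ 1`
(`inTableClass_twinRotorTable`).  On the diagonal `x_{0,·} = x_{1,·}` the two rotors add up to the
dyadic chain: the sibling proof file shows that `twinRotorEmbed W : (n, σ) ↦ (W_n(σ)₀ / 2) • (1,1,0,0)`
maps admissible (viscous) eternal solutions of `dyadicTable` to admissible (viscous) eternal solutions of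
`twinRotorTable` with the same covariant viscosity, half the shell energies, the same uniform bound up to
`√2`, and the same forward survival — so every K1-type statement at spread `R ≥ 1` already contains its
dyadic member.  HONEST LABEL: vocabulary; every stub of ⟨20419⟩/⟨20420⟩/⟨20205⟩ remains OPEN.
-/

noncomputable section

-- the sub-problem namespace repeats the summit name by design (D-0017)
set_option linter.dupNamespace false

namespace Summit.NavierStokesRegularity.NavierStokesRegularity.Theorems.TaoLadderRungTwoBreakTwinRotor

open Literature.Analysis.FluidPDE Literature.Analysis.FluidPDE.TaoCascade

/-- **The twin-rotor table** on `ℝ⁴` (modes `2, 3` idle): cross feeds `α_{01i,(0,0,1)} = α_{10i,(0,0,1)} = 1`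
for `i ∈ {0, 1}` (the monomial `x_{0,n-1}x_{1,n-1}` drives BOTH twins of shell `n`), back-reactions
`α_{101,(1,0,0)} = α_{011,(0,1,0)} = −1` (the monomial `x_{1,n+1} x_{0,n}` drives `x_{1,n}`) and
`α_{010,(1,0,0)} = α_{100,(0,1,0)} = −1` (the monomial `x_{0,n+1} x_{1,n}` drives `x_{0,n}`); all other
entries `0` (in particular no intra-shell block and no square monomial).
[cite: Tao2016AveragedNS, §4 (4.1)–(4.3) (structure constants on the shift set, symmetry, cancellation); cell vocabulary (route TaoLadderRungTwoBreak, this hand's twin-rotor table)] -/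
def twinRotorTable : Fin 4 → Fin 4 → Fin 4 → ℤ × ℤ × ℤ → ℝ := fun i₁ i₂ i₃ μ =>
  if μ = ((0 : ℤ), (0 : ℤ), (1 : ℤ)) then
    (if ((i₁ = 0 ∧ i₂ = 1) ∨ (i₁ = 1 ∧ i₂ = 0)) ∧ (i₃ = 0 ∨ i₃ = 1) then 1 else 0)
  else if μ = ((1 : ℤ), (0 : ℤ), (0 : ℤ)) then
    (if (i₁ = 1 ∧ i₂ = 0 ∧ i₃ = 1) ∨ (i₁ = 0 ∧ i₂ = 1 ∧ i₃ = 0) then -1 else 0)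
  else if μ = ((0 : ℤ), (1 : ℤ), (0 : ℤ)) then
    (if (i₁ = 0 ∧ i₂ = 1 ∧ i₃ = 1) ∨ (i₁ = 1 ∧ i₂ = 0 ∧ i₃ = 0) then -1 else 0)
  else 0

/-- Symmetry (4.2) of the twin-rotor table. [cite: Tao2016AveragedNS, §4 (4.2)] -/
theorem twinRotorTable_symmetric : IsSymmetricCoeff twinRotorTable := by
  intro i₁ i₂ i₃ μ₁ μ₂ μ₃ hμ
  rw [mem_shiftSet_iff] at hμ
  simp only [Prod.mk.injEq] at hμ
  rcases hμ with ⟨rfl, rfl, rfl⟩ | ⟨rfl, rfl, rfl⟩ | ⟨rfl, rfl, rfl⟩ | ⟨rfl, rfl, rfl⟩ <;>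
    fin_cases i₁ <;> fin_cases i₂ <;> fin_cases i₃ <;> simp [twinRotorTable]

/-- Cancellation (4.3) of the twin-rotor table (each of the two rotors conserves the energy of its triad:
the feed coefficient `1` is cancelled by the back-reaction `−1`, the catalyst direction carries `0`).
[cite: Tao2016AveragedNS, §4 (4.3)] -/
theorem twinRotorTable_cancelling : IsCancellingCoeff twinRotorTable := by
  intro i₁ i₂ i₃ μ₁ μ₂ μ₃ hμ
  rw [mem_shiftSet_iff] at hμ
  simp only [Prod.mk.injEq] at hμ
  rcases hμ with ⟨rfl, rfl, rfl⟩ | ⟨rfl, rfl, rfl⟩ | ⟨rfl, rfl, rfl⟩ | ⟨rfl, rfl, rfl⟩ <;>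
    fin_cases i₁ <;> fin_cases i₂ <;> fin_cases i₃ <;> simp [twinRotorTable]

/-- Every entry of the twin-rotor table is `0`, `1` or `−1`. [cite: Tao2016AveragedNS, §4 (4.1); cell vocabulary] -/
theorem twinRotorTable_values (i₁ i₂ i₃ : Fin 4) (μ : ℤ × ℤ × ℤ) :
    twinRotorTable i₁ i₂ i₃ μ = 0 ∨ twinRotorTable i₁ i₂ i₃ μ = 1 ∨ twinRotorTable i₁ i₂ i₃ μ = -1 := by
  unfold twinRotorTable
  split_ifs <;> simp

/-- `R`-comparability of the twin-rotor table for every spread `R ≥ 1` (all non-zero entries have modulus `1`).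
[cite: Tao2016AveragedNS, §6.1; cell vocabulary (`IsComparableCoeff`)] -/
theorem twinRotorTable_comparable {R : ℝ} (hR : 1 ≤ R) : IsComparableCoeff R twinRotorTable := by
  intro i₁ i₂ i₃ μ _
  have hRinv : R⁻¹ ≤ 1 := inv_le_one_of_one_le₀ hR
  rcases twinRotorTable_values i₁ i₂ i₃ μ with h | h | h <;> rw [h]
  · simp
  · exact ⟨by simp, Or.inr (by simpa using hRinv)⟩
  · exact ⟨by simp, Or.inr (by simpa using hRinv)⟩

/-- **The twin-rotor table is a member of `E₂(R)` for every `R ≥ 1`** — in particular of the spread-one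
class `E₂(1)`, below the dyadic spread. [cite: Tao2016AveragedNS, §4 (4.2)–(4.3), §6.1; cell vocabulary (`InTableClass`)] -/
theorem inTableClass_twinRotorTable {R : ℝ} (hR : 1 ≤ R) : InTableClass R twinRotorTable :=
  ⟨twinRotorTable_symmetric, twinRotorTable_cancelling, twinRotorTable_comparable hR⟩

/-- The diagonal direction `(1, 1, 0, 0) ∈ ℝ⁴` of the twin modes.
[cite: Tao2016AveragedNS, §4 Lemma 4.1 (the amplitudes `X_{i,n}` of one shell); cell vocabulary] -/
def twinRotorDir : Em 4 := EuclideanSpace.single 0 1 + EuclideanSpace.single 1 1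

/-- Components of the diagonal direction: `(1, 1, 0, 0)`. [elementary] -/
theorem twinRotorDir_apply (i : Fin 4) : twinRotorDir i = if i = 0 ∨ i = 1 then 1 else 0 := by
  unfold twinRotorDir
  fin_cases i <;> simp

/-- **The twin embedding** of a shell family `W : ℤ → ℝ → ℝ⁴`: shell `n` at log-time `σ` carries
`(W_n(σ)₀ / 2) · (1, 1, 0, 0)` — half the scalar amplitude on each twin.  (On admissible eternal solutions of
`dyadicTable`, which are supported on component `0`, this halves every shell energy.)
[cite: Tao2016AveragedNS, §1.2 (dyadic model), §4 Lemma 4.1 (4.8), §6.4; cell vocabulary (route TaoLadderRungTwoBreak, this hand's twin embedding)] -/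
def twinRotorEmbed (W : ℤ → ℝ → Em 4) : ℤ → ℝ → Em 4 := fun n σ => (W n σ 0 / 2) • twinRotorDir

/-- Unfolding the twin embedding. [elementary] -/
theorem twinRotorEmbed_apply (W : ℤ → ℝ → Em 4) (n : ℤ) (σ : ℝ) :
    twinRotorEmbed W n σ = (W n σ 0 / 2) • twinRotorDir := rfl

end Summit.NavierStokesRegularity.NavierStokesRegularity.Theorems.TaoLadderRungTwoBreakTwinRotor

end
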